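import Summits.ValiantsHypothesis.ValiantsHypothesis.Theorems.KPlusLogSqLawStaticTridiagonalFourByFourSharpFacts

/-!
# Sharp four-by-four law, Part 9b: an IRREDUCIBLE static definite tridiagonal `4 × 4` design has at most THREE positive determinant zeros

HONEST FRAMING.  Helper theorems (`--supports stmt-ValiantsHypothesis-19561 --as helper`; seat val-sym-lift-p2 g9, cell `pub-symmetroid`, 2026-08-27) on the REAL side of the desk's typed α target (lead R2102/R2114), size `m = 4`: the SHARP all-designs value `B 4 = 3` (Part 6 gave `≤ 4` from the two class laws alone).  This part: the counting argument for irreducible designs.  Nothing here bears on `WeakLifting` (stmt-19561) / `TropicalB` (stmt-19771) in their windows, Conjecture B,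
the Door-A registers, `MatrixDescartes` (stmt-ValiantsHypothesis-18050) or VP ≠ VNP; α status NO MOVER (calibration row at one size).

WHAT IS PROVED.  **`card_posRoots_four_le_three`** — if both inertia classes are inhabited then `U` and `V` are strictly monotone in the same direction, and on one of the two classes `(1 − U)(1 − V)` and `W` are oppositely monotone, so that class carries at most one zero: `2 + 1 = 3`.  One `maxHeartbeats` raise (a single long elementary case analysis). [this file; Part 9a]
-/

set_option linter.dupNamespace false
set_option autoImplicit false

namespace Summit.ValiantsHypothesis.ValiantsHypothesis.Theorems.KPlusLogSqLaw.DefiniteInterpolation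

open Summit.ValiantsHypothesis.ValiantsHypothesis.Theorems.ValuativeFlip (ctK ctK_zero ctK_one ctK_two ctK_add_two)
open Polynomial

section FourSharp

-- one long elementary case analysis (four sign cases × two classes); the default heartbeat budget does not suffice
set_option maxHeartbeats 800000 in
/-- **FOUR-BY-FOUR LAW, SHARP FORM (irreducible designs): at most THREE positive determinant zeros.**  For an irreducible static
definite tridiagonal `4 × 4` design the positive zeros are the positive solutions of `(1 − U)(1 − V) = W`, where
`U = w₀/(d₀d₁)`, `W = w₁/(d₁d₂)`, `V = w₂/(d₂d₃)` are the three normalised link weights (monomials in `t`); a zero is in the bottom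
class iff `U < 1` iff `V < 1`, in the top class iff `U > 1` iff `V > 1` (the two classes carry ≤ 2 zeros each by Parts 2/3b).  If both
classes are inhabited then `U` and `V` are strictly monotone in the SAME direction, and then on one of the two classes `(1−U)(1−V)` and `W`
are monotone in opposite directions, so that class carries at most ONE zero: `2 + 1 = 3`. [this file] -/
theorem card_posRoots_four_le_three (c : Fin 4 → Fin 4 → ℝ) (e : Fin 4 → Fin 4 → ℕ) (hc : ∀ i j, c i j = c j i)
    (hband : ∀ i j : Fin 4, (i : ℕ) + 1 < j ∨ (j : ℕ) + 1 < i → c i j = 0) (hpos : ∀ i, 0 < c i i)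
    (hirr : ∀ (k : ℕ) (hk : k + 1 < 4), c ⟨k, by omega⟩ ⟨k + 1, hk⟩ ≠ 0) :
    ((Matrix.det (Matrix.of fun i j => C (c i j) * (X : ℝ[X]) ^ e i j)).roots.toFinset.filter
      (fun t : ℝ => 0 < t)).card ≤ 3 := by
  set P : ℝ[X] := Matrix.det (Matrix.of fun i j => C (c i j) * (X : ℝ[X]) ^ e i j) with hP
  -- the three normalised link weights
  set U : ℝ → ℝ := fun t => (c ⟨0, by omega⟩ ⟨1, by omega⟩ * c ⟨1, by omega⟩ ⟨0, by omega⟩) * t ^ (e ⟨0, by omega⟩ ⟨1, by omega⟩ + e ⟨1, by omega⟩ ⟨0, by omega⟩) / ((c ⟨0, by omega⟩ ⟨0, by omega⟩ * c ⟨1, by omega⟩ ⟨1, by omega⟩) * t ^ (e ⟨0, by omega⟩ ⟨0, by omega⟩ + e ⟨1, by omega⟩ ⟨1, by omega⟩)) with hU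
  set W : ℝ → ℝ := fun t => (c ⟨1, by omega⟩ ⟨2, by omega⟩ * c ⟨2, by omega⟩ ⟨1, by omega⟩) * t ^ (e ⟨1, by omega⟩ ⟨2, by omega⟩ + e ⟨2, by omega⟩ ⟨1, by omega⟩) / ((c ⟨1, by omega⟩ ⟨1, by omega⟩ * c ⟨2, by omega⟩ ⟨2, by omega⟩) * t ^ (e ⟨1, by omega⟩ ⟨1, by omega⟩ + e ⟨2, by omega⟩ ⟨2, by omega⟩)) with hW
  set V : ℝ → ℝ := fun t => (c ⟨2, by omega⟩ ⟨3, by omega⟩ * c ⟨3, by omega⟩ ⟨2, by omega⟩) * t ^ (e ⟨2, by omega⟩ ⟨3, by omega⟩ + e ⟨3, by omega⟩ ⟨2, by omega⟩) / ((c ⟨2, by omega⟩ ⟨2, by omega⟩ * c ⟨3, by omega⟩ ⟨3, by omega⟩) * t ^ (e ⟨2, by omega⟩ ⟨2, by omega⟩ + e ⟨3, by omega⟩ ⟨3, by omega⟩)) with hV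
  have hw0 : 0 < c ⟨0, by omega⟩ ⟨1, by omega⟩ * c ⟨1, by omega⟩ ⟨0, by omega⟩ := by rw [hc ⟨1, by omega⟩]; exact mul_self_pos.mpr (hirr 0 (by omega))
  have hw1 : 0 < c ⟨1, by omega⟩ ⟨2, by omega⟩ * c ⟨2, by omega⟩ ⟨1, by omega⟩ := by rw [hc ⟨2, by omega⟩]; exact mul_self_pos.mpr (hirr 1 (by omega))
  have hw2 : 0 < c ⟨2, by omega⟩ ⟨3, by omega⟩ * c ⟨3, by omega⟩ ⟨2, by omega⟩ := by rw [hc ⟨3, by omega⟩]; exact mul_self_pos.mpr (hirr 2 (by omega))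
  have hd01 : 0 < c ⟨0, by omega⟩ ⟨0, by omega⟩ * c ⟨1, by omega⟩ ⟨1, by omega⟩ := mul_pos (hpos _) (hpos _)
  have hd12 : 0 < c ⟨1, by omega⟩ ⟨1, by omega⟩ * c ⟨2, by omega⟩ ⟨2, by omega⟩ := mul_pos (hpos _) (hpos _)
  have hd23 : 0 < c ⟨2, by omega⟩ ⟨2, by omega⟩ * c ⟨3, by omega⟩ ⟨3, by omega⟩ := mul_pos (hpos _) (hpos _)
  have hWpos : ∀ t : ℝ, 0 < t → 0 < W t := fun t ht => div_pos (mul_pos hw1 (pow_pos ht _)) (mul_pos hd12 (pow_pos ht _))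
  have hfact : ∀ t : ℝ, 0 < t → P.IsRoot t → (1 - U t) * (1 - V t) = W t ∧
      (0 < ctK (fun s : ℕ => if h : s < 4 then c ⟨s, h⟩ ⟨s, h⟩ * t ^ e ⟨s, h⟩ ⟨s, h⟩ else 1)
          (fun s : ℕ => -(if h : s + 1 < 4 then c ⟨s, by omega⟩ ⟨s + 1, h⟩ * t ^ e ⟨s, by omega⟩ ⟨s + 1, h⟩ else 0))
          (fun s : ℕ => if h : 1 ≤ s ∧ s < 4 then c ⟨s, h.2⟩ ⟨s - 1, by omega⟩ * t ^ e ⟨s, h.2⟩ ⟨s - 1, by omega⟩ else 0) 2 ↔ U t < 1) ∧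
      ctK (fun s : ℕ => if h : s < 4 then c ⟨s, h⟩ ⟨s, h⟩ * t ^ e ⟨s, h⟩ ⟨s, h⟩ else 1)
          (fun s : ℕ => -(if h : s + 1 < 4 then c ⟨s, by omega⟩ ⟨s + 1, h⟩ * t ^ e ⟨s, by omega⟩ ⟨s + 1, h⟩ else 0))
          (fun s : ℕ => if h : 1 ≤ s ∧ s < 4 then c ⟨s, h.2⟩ ⟨s - 1, by omega⟩ * t ^ e ⟨s, h.2⟩ ⟨s - 1, by omega⟩ else 0) 2 ≠ 0 ∧
      0 < ctK (fun s : ℕ => if h : s < 4 then c ⟨s, h⟩ ⟨s, h⟩ * t ^ e ⟨s, h⟩ ⟨s, h⟩ else 1)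
          (fun s : ℕ => -(if h : s + 1 < 4 then c ⟨s, by omega⟩ ⟨s + 1, h⟩ * t ^ e ⟨s, by omega⟩ ⟨s + 1, h⟩ else 0))
          (fun s : ℕ => if h : 1 ≤ s ∧ s < 4 then c ⟨s, h.2⟩ ⟨s - 1, by omega⟩ * t ^ e ⟨s, h.2⟩ ⟨s - 1, by omega⟩ else 0) 3 * ctK (fun s : ℕ => if h : s < 4 then c ⟨s, h⟩ ⟨s, h⟩ * t ^ e ⟨s, h⟩ ⟨s, h⟩ else 1)
          (fun s : ℕ => -(if h : s + 1 < 4 then c ⟨s, by omega⟩ ⟨s + 1, h⟩ * t ^ e ⟨s, by omega⟩ ⟨s + 1, h⟩ else 0))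
          (fun s : ℕ => if h : 1 ≤ s ∧ s < 4 then c ⟨s, h.2⟩ ⟨s - 1, by omega⟩ * t ^ e ⟨s, h.2⟩ ⟨s - 1, by omega⟩ else 0) 2 :=
    fun t ht hroot => four_root_facts c e hc hband hpos hirr ht hroot
  -- monotonicity of the three monomial ratios
  have hUmono : ∀ a b : ℝ, 0 < a → a < b →
      ((e ⟨0, by omega⟩ ⟨0, by omega⟩ + e ⟨1, by omega⟩ ⟨1, by omega⟩) < (e ⟨0, by omega⟩ ⟨1, by omega⟩ + e ⟨1, by omega⟩ ⟨0, by omega⟩) → U a < U b) ∧ ((e ⟨0, by omega⟩ ⟨1, by omega⟩ + e ⟨1, by omega⟩ ⟨0, by omega⟩) < (e ⟨0, by omega⟩ ⟨0, by omega⟩ + e ⟨1, by omega⟩ ⟨1, by omega⟩) → U b < U a) ∧ ((e ⟨0, by omega⟩ ⟨1, by omega⟩ + e ⟨1, by omega⟩ ⟨0, by omega⟩) = (e ⟨0, by omega⟩ ⟨0, by omega⟩ + e ⟨1, by omega⟩ ⟨1, by omega⟩) → U a = U b) :=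
    fun a b ha hab => monomialRatio_compare hw0 hd01 ha hab _ _
  have hVmono : ∀ a b : ℝ, 0 < a → a < b →
      ((e ⟨2, by omega⟩ ⟨2, by omega⟩ + e ⟨3, by omega⟩ ⟨3, by omega⟩) < (e ⟨2, by omega⟩ ⟨3, by omega⟩ + e ⟨3, by omega⟩ ⟨2, by omega⟩) → V a < V b) ∧ ((e ⟨2, by omega⟩ ⟨3, by omega⟩ + e ⟨3, by omega⟩ ⟨2, by omega⟩) < (e ⟨2, by omega⟩ ⟨2, by omega⟩ + e ⟨3, by omega⟩ ⟨3, by omega⟩) → V b < V a) ∧ ((e ⟨2, by omega⟩ ⟨3, by omega⟩ + e ⟨3, by omega⟩ ⟨2, by omega⟩) = (e ⟨2, by omega⟩ ⟨2, by omega⟩ + e ⟨3, by omega⟩ ⟨3, by omega⟩) → V a = V b) :=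
    fun a b ha hab => monomialRatio_compare hw2 hd23 ha hab _ _
  have hWmono : ∀ a b : ℝ, 0 < a → a < b →
      ((e ⟨1, by omega⟩ ⟨1, by omega⟩ + e ⟨2, by omega⟩ ⟨2, by omega⟩) < (e ⟨1, by omega⟩ ⟨2, by omega⟩ + e ⟨2, by omega⟩ ⟨1, by omega⟩) → W a < W b) ∧ ((e ⟨1, by omega⟩ ⟨2, by omega⟩ + e ⟨2, by omega⟩ ⟨1, by omega⟩) < (e ⟨1, by omega⟩ ⟨1, by omega⟩ + e ⟨2, by omega⟩ ⟨2, by omega⟩) → W b < W a) ∧ ((e ⟨1, by omega⟩ ⟨2, by omega⟩ + e ⟨2, by omega⟩ ⟨1, by omega⟩) = (e ⟨1, by omega⟩ ⟨1, by omega⟩ + e ⟨2, by omega⟩ ⟨2, by omega⟩) → W a = W b) :=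
    fun a b ha hab => monomialRatio_compare hw1 hd12 ha hab _ _
  -- the positive roots, split by the sign of 1 − U (= the inertia class)
  set Ppos := P.roots.toFinset.filter (fun t : ℝ => 0 < t) with hPpos
  have hmem : ∀ t ∈ Ppos, 0 < t ∧ P.IsRoot t := by
    intro t ht
    rw [hPpos, Finset.mem_filter, Multiset.mem_toFinset, Polynomial.mem_roots'] at ht
    exact ⟨ht.2, ht.1.2⟩
  set S₀ := Ppos.filter (fun t : ℝ => U t < 1) with hS₀
  set S₁ := Ppos.filter (fun t : ℝ => 1 < U t) with hS₁
  -- class facts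
  have hcl0 : ∀ t ∈ S₀, 0 < t ∧ U t < 1 ∧ V t < 1 ∧ (1 - U t) * (1 - V t) = W t := by
    intro t ht
    rw [hS₀, Finset.mem_filter] at ht
    obtain ⟨htP, hU1⟩ := ht
    obtain ⟨ht0, hr⟩ := hmem t htP
    obtain ⟨hid, -, -, -⟩ := hfact t ht0 hr
    refine ⟨ht0, hU1, ?_, hid⟩
    by_contra hV1
    rw [not_lt] at hV1
    have : (1 - U t) * (1 - V t) ≤ 0 := mul_nonpos_of_nonneg_of_nonpos (by linarith) (by linarith)
    linarith [hWpos t ht0]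
  have hcl1 : ∀ t ∈ S₁, 0 < t ∧ 1 < U t ∧ 1 < V t ∧ (1 - U t) * (1 - V t) = W t := by
    intro t ht
    rw [hS₁, Finset.mem_filter] at ht
    obtain ⟨htP, hU1⟩ := ht
    obtain ⟨ht0, hr⟩ := hmem t htP
    obtain ⟨hid, -, -, -⟩ := hfact t ht0 hr
    refine ⟨ht0, hU1, ?_, hid⟩
    by_contra hV1
    rw [not_lt] at hV1
    have : (1 - U t) * (1 - V t) ≤ 0 := mul_nonpos_of_nonpos_of_nonneg (by linarith) (by linarith)
    linarith [hWpos t ht0]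
  -- P₊ ⊆ S₀ ∪ S₁ (U = 1 is impossible at a root)
  have hsplit : Ppos ⊆ S₀ ∪ S₁ := by
    intro t ht
    obtain ⟨ht0, hr⟩ := hmem t ht
    obtain ⟨hid, -, -, -⟩ := hfact t ht0 hr
    rw [Finset.mem_union]
    rcases lt_trichotomy (U t) 1 with h | h | h
    · left; exact Finset.mem_filter.mpr ⟨ht, h⟩
    · exfalso; rw [h, sub_self, zero_mul] at hid; linarith [hWpos t ht0]
    · right; exact Finset.mem_filter.mpr ⟨ht, h⟩
  -- each class carries at most two zeros (Parts 2 and 3b)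
  have hS₀2 : S₀.card ≤ 2 := four_card_filter_U_lt_one_le_two c e hc hband hpos hirr
  have hS₁2 : S₁.card ≤ 2 := four_card_filter_one_lt_U_le_two c e hc hband hpos hirr
  have hcard : Ppos.card ≤ S₀.card + S₁.card :=
    le_trans (Finset.card_le_card hsplit) (Finset.card_union_le _ _)
  -- if one class is empty we are done
  by_cases he0 : S₀ = ∅
  · rw [he0, Finset.card_empty, zero_add] at hcard; omega
  by_cases he1 : S₁ = ∅
  · rw [he1, Finset.card_empty, add_zero] at hcard; omega
  obtain ⟨t₀, ht₀⟩ := Finset.nonempty_iff_ne_empty.mpr he0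
  obtain ⟨t₁, ht₁⟩ := Finset.nonempty_iff_ne_empty.mpr he1
  obtain ⟨ht₀0, hU₀, hV₀, -⟩ := hcl0 t₀ ht₀
  obtain ⟨ht₁0, hU₁, hV₁, -⟩ := hcl1 t₁ ht₁
  have hne : t₀ ≠ t₁ := by rintro rfl; linarith
  -- «at most one» lemmas for a class on which (1−U)(1−V) and W are oppositely monotone
  have one0 : (∀ a ∈ S₀, ∀ b ∈ S₀, a < b → (1 - U b) * (1 - V b) < (1 - U a) * (1 - V a) ∧ W a ≤ W b) → S₀.card ≤ 1 := by
    intro H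
    refine Finset.card_le_one.mpr fun a ha b hb => ?_
    by_contra hab
    rcases lt_or_gt_of_ne hab with h | h
    · obtain ⟨h1, h2⟩ := H a ha b hb h
      obtain ⟨-, -, -, ida⟩ := hcl0 a ha
      obtain ⟨-, -, -, idb⟩ := hcl0 b hb
      linarith
    · obtain ⟨h1, h2⟩ := H b hb a ha h
      obtain ⟨-, -, -, ida⟩ := hcl0 a ha
      obtain ⟨-, -, -, idb⟩ := hcl0 b hb
      linarith
  have one0' : (∀ a ∈ S₀, ∀ b ∈ S₀, a < b → (1 - U a) * (1 - V a) < (1 - U b) * (1 - V b) ∧ W b ≤ W a) → S₀.card ≤ 1 := by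
    intro H
    refine Finset.card_le_one.mpr fun a ha b hb => ?_
    by_contra hab
    rcases lt_or_gt_of_ne hab with h | h
    · obtain ⟨h1, h2⟩ := H a ha b hb h
      obtain ⟨-, -, -, ida⟩ := hcl0 a ha
      obtain ⟨-, -, -, idb⟩ := hcl0 b hb
      linarith
    · obtain ⟨h1, h2⟩ := H b hb a ha h
      obtain ⟨-, -, -, ida⟩ := hcl0 a ha
      obtain ⟨-, -, -, idb⟩ := hcl0 b hb
      linarith
  have one1 : (∀ a ∈ S₁, ∀ b ∈ S₁, a < b → (1 - U a) * (1 - V a) < (1 - U b) * (1 - V b) ∧ W b ≤ W a) → S₁.card ≤ 1 := by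
    intro H
    refine Finset.card_le_one.mpr fun a ha b hb => ?_
    by_contra hab
    rcases lt_or_gt_of_ne hab with h | h
    · obtain ⟨h1, h2⟩ := H a ha b hb h
      obtain ⟨-, -, -, ida⟩ := hcl1 a ha
      obtain ⟨-, -, -, idb⟩ := hcl1 b hb
      linarith
    · obtain ⟨h1, h2⟩ := H b hb a ha h
      obtain ⟨-, -, -, ida⟩ := hcl1 a ha
      obtain ⟨-, -, -, idb⟩ := hcl1 b hb
      linarith
  have one1' : (∀ a ∈ S₁, ∀ b ∈ S₁, a < b → (1 - U b) * (1 - V b) < (1 - U a) * (1 - V a) ∧ W a ≤ W b) → S₁.card ≤ 1 := by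
    intro H
    refine Finset.card_le_one.mpr fun a ha b hb => ?_
    by_contra hab
    rcases lt_or_gt_of_ne hab with h | h
    · obtain ⟨h1, h2⟩ := H a ha b hb h
      obtain ⟨-, -, -, ida⟩ := hcl1 a ha
      obtain ⟨-, -, -, idb⟩ := hcl1 b hb
      linarith
    · obtain ⟨h1, h2⟩ := H b hb a ha h
      obtain ⟨-, -, -, ida⟩ := hcl1 a ha
      obtain ⟨-, -, -, idb⟩ := hcl1 b hb
      linarith
  -- case analysis on the directions of U and V (they must agree, strictly)
  rcases lt_trichotomy (e ⟨0, by omega⟩ ⟨0, by omega⟩ + e ⟨1, by omega⟩ ⟨1, by omega⟩) (e ⟨0, by omega⟩ ⟨1, by omega⟩ + e ⟨1, by omega⟩ ⟨0, by omega⟩) with hUi | hUe | hUd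
  · -- U increasing ⇒ t₀ < t₁ ⇒ V increasing
    have ht01 : t₀ < t₁ := by
      by_contra h
      rcases lt_or_eq_of_le (not_lt.mp h) with h' | h'
      · have := (hUmono t₁ t₀ ht₁0 h').1 hUi; linarith
      · exact hne h'.symm
    have hVi : (e ⟨2, by omega⟩ ⟨2, by omega⟩ + e ⟨3, by omega⟩ ⟨3, by omega⟩) < (e ⟨2, by omega⟩ ⟨3, by omega⟩ + e ⟨3, by omega⟩ ⟨2, by omega⟩) := by
      rcases lt_trichotomy (e ⟨2, by omega⟩ ⟨2, by omega⟩ + e ⟨3, by omega⟩ ⟨3, by omega⟩) (e ⟨2, by omega⟩ ⟨3, by omega⟩ + e ⟨3, by omega⟩ ⟨2, by omega⟩) with h | h | h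
      · exact h
      · have := (hVmono t₀ t₁ ht₀0 ht01).2.2 h.symm; linarith
      · have := (hVmono t₀ t₁ ht₀0 ht01).2.1 h; linarith
    rcases le_or_gt (e ⟨1, by omega⟩ ⟨1, by omega⟩ + e ⟨2, by omega⟩ ⟨2, by omega⟩) (e ⟨1, by omega⟩ ⟨2, by omega⟩ + e ⟨2, by omega⟩ ⟨1, by omega⟩) with hWi | hWd
    · -- W non-decreasing: the bottom class has at most one zero
      have : S₀.card ≤ 1 := one0 (fun a ha b hb hab => by
        obtain ⟨ha0, hUa, hVa, -⟩ := hcl0 a ha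
        obtain ⟨hb0, hUb, hVb, -⟩ := hcl0 b hb
        have hU' := (hUmono a b ha0 hab).1 hUi
        have hV' := (hVmono a b ha0 hab).1 hVi
        refine ⟨mul_lt_mul'' (by linarith) (by linarith) (sub_pos.mpr hUb).le (sub_pos.mpr hVb).le, ?_⟩
        rcases lt_or_eq_of_le hWi with h | h
        · exact ((hWmono a b ha0 hab).1 h).le
        · exact ((hWmono a b ha0 hab).2.2 h.symm).le)
      omega
    · -- W decreasing: the top class has at most one zero
      have : S₁.card ≤ 1 := one1 (fun a ha b hb hab => by
        obtain ⟨ha0, hUa, hVa, -⟩ := hcl1 a ha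
        obtain ⟨hb0, hUb, hVb, -⟩ := hcl1 b hb
        have hU' := (hUmono a b ha0 hab).1 hUi
        have hV' := (hVmono a b ha0 hab).1 hVi
        refine ⟨?_, ((hWmono a b ha0 hab).2.1 hWd).le⟩
        have hm : (U a - 1) * (V a - 1) < (U b - 1) * (V b - 1) :=
          mul_lt_mul'' (by linarith) (by linarith) (by linarith) (by linarith)
        have e1 : (1 - U a) * (1 - V a) = (U a - 1) * (V a - 1) := by ring
        have e2 : (1 - U b) * (1 - V b) = (U b - 1) * (V b - 1) := by ring
        rw [e1, e2]; exact hm)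
      omega
  · have := (hUmono (min t₀ t₁) (max t₀ t₁) (lt_min ht₀0 ht₁0) (min_lt_max.mpr hne)).2.2 hUe.symm
    rcases le_total t₀ t₁ with h | h
    · rw [min_eq_left h, max_eq_right h] at this; linarith
    · rw [min_eq_right h, max_eq_left h] at this; linarith
  · -- U decreasing ⇒ t₁ < t₀ ⇒ V decreasing
    have ht10 : t₁ < t₀ := by
      by_contra h
      rcases lt_or_eq_of_le (not_lt.mp h) with h' | h'
      · have := (hUmono t₀ t₁ ht₀0 h').2.1 hUd; linarith
      · exact hne h'
    have hVd : (e ⟨2, by omega⟩ ⟨3, by omega⟩ + e ⟨3, by omega⟩ ⟨2, by omega⟩) < (e ⟨2, by omega⟩ ⟨2, by omega⟩ + e ⟨3, by omega⟩ ⟨3, by omega⟩) := by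
      rcases lt_trichotomy (e ⟨2, by omega⟩ ⟨2, by omega⟩ + e ⟨3, by omega⟩ ⟨3, by omega⟩) (e ⟨2, by omega⟩ ⟨3, by omega⟩ + e ⟨3, by omega⟩ ⟨2, by omega⟩) with h | h | h
      · have := (hVmono t₁ t₀ ht₁0 ht10).1 h; linarith
      · have := (hVmono t₁ t₀ ht₁0 ht10).2.2 h.symm; linarith
      · exact h
    rcases le_or_gt (e ⟨1, by omega⟩ ⟨2, by omega⟩ + e ⟨2, by omega⟩ ⟨1, by omega⟩) (e ⟨1, by omega⟩ ⟨1, by omega⟩ + e ⟨2, by omega⟩ ⟨2, by omega⟩) with hWd | hWi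
    · -- W non-increasing: the bottom class has at most one zero
      have : S₀.card ≤ 1 := one0' (fun a ha b hb hab => by
        obtain ⟨ha0, hUa, hVa, -⟩ := hcl0 a ha
        obtain ⟨hb0, hUb, hVb, -⟩ := hcl0 b hb
        have hU' := (hUmono a b ha0 hab).2.1 hUd
        have hV' := (hVmono a b ha0 hab).2.1 hVd
        refine ⟨mul_lt_mul'' (by linarith) (by linarith) (sub_pos.mpr hUa).le (sub_pos.mpr hVa).le, ?_⟩
        rcases lt_or_eq_of_le hWd with h | h
        · exact ((hWmono a b ha0 hab).2.1 h).le
        · exact ((hWmono a b ha0 hab).2.2 h).symm.le)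
      omega
    · -- W increasing: the top class has at most one zero
      have : S₁.card ≤ 1 := one1' (fun a ha b hb hab => by
        obtain ⟨ha0, hUa, hVa, -⟩ := hcl1 a ha
        obtain ⟨hb0, hUb, hVb, -⟩ := hcl1 b hb
        have hU' := (hUmono a b ha0 hab).2.1 hUd
        have hV' := (hVmono a b ha0 hab).2.1 hVd
        refine ⟨?_, ((hWmono a b ha0 hab).1 hWi).le⟩
        have hm : (U b - 1) * (V b - 1) < (U a - 1) * (V a - 1) :=
          mul_lt_mul'' (by linarith) (by linarith) (by linarith) (by linarith)
        have e1 : (1 - U a) * (1 - V a) = (U a - 1) * (V a - 1) := by ring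
        have e2 : (1 - U b) * (1 - V b) = (U b - 1) * (V b - 1) := by ring
        rw [e1, e2]; exact hm)
      omega

end FourSharp

end Summit.ValiantsHypothesis.ValiantsHypothesis.Theorems.KPlusLogSqLaw.DefiniteInterpolation
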